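import Summits.FinalStateConjecture.FinalStateConjecture.Theorems.EIHFluxBalanceInertialRecessionStubRechart3ChartBounds
import Summits.FinalStateConjecture.FinalStateConjecture.Theorems.EIHFluxBalanceInertialRecessionStubRechart3InverseFrame

/-!
# Route EIHFluxBalance — `InertialRecession`, re-charting: the frame defect of the honest chart

Helper file for the crux `stmt-FinalStateConjecture-10166`
(`Summit.FinalStateConjecture.FinalStateConjecture.Theses.EIHFluxBalance.InertialRecession`),
line `sublinear-is-free-clean-window-charges`, stub `stub_rechart` (the transfer P2), part G1.

The pulled-back own summand of a hole chart reads the Kerr–Schild form in the **transported frame**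
`S(y) = (Λ̃ (T y))⁻¹ ∘ Dψ(y)`; its deviation from the rest-frame form is governed by the **frame
defect** `E(y) = S(y) − 1`. On the region `Q(τ₁, R)` this file bounds `E` in `C²`:
`‖E‖, ‖DE‖, ‖D²E‖ ≤ 6000 γ⁵(1+R)⁶ δ` (`norm_iteratedFDeriv_frameDefect_le`), from the C³-closeness
of `ψ` to the frozen Poincaré map (`…StubRechart3ChartBounds`) and the slow variation of the inverse
frame (`…StubRechart3InverseFrame`). Decomposition: `E = Λ̃(T)⁻¹ ∘ (Dψ − Λ̃(T₀τ₁)) + (Λ̃(T)⁻¹ ∘ Λ̃(T₀τ₁) − 1)`,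
the second term vanishing at the centre `(τ₁, 0)`. [folklore]
-/

noncomputable section

set_option linter.dupNamespace false

open Set Filter Function Metric Topology
open scoped ContDiff
open Literature.Geometry.Lorentzian

namespace Summit.FinalStateConjecture.FinalStateConjecture.Theorems.SublinearIsFree.Rechart

/-! ### Generic: post-composition with a fixed operator -/

/-- Composition of an operator field with a fixed continuous linear map on the left does not increase
iterated derivatives by more than the operator norm. [folklore] -/
theorem norm_iteratedFDeriv_clm_comp_left_le {E F G : Type*} [NormedAddCommGroup E] [NormedSpace ℝ E]
    [NormedAddCommGroup F] [NormedSpace ℝ F] [NormedAddCommGroup G] [NormedSpace ℝ G]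
    (L : F →L[ℝ] G) {f : E → F} (hf : ContDiff ℝ ∞ f) (x : E) (i : ℕ) :
    ‖iteratedFDeriv ℝ i (fun y ↦ L (f y)) x‖ ≤ ‖L‖ * ‖iteratedFDeriv ℝ i f x‖ := by
  rw [show (fun y ↦ L (f y)) = L ∘ f from rfl,
    L.iteratedFDeriv_comp_left hf.contDiffAt (i := i) (by exact_mod_cast le_top)]
  exact L.norm_compContinuousMultilinearMap_le _

/-- Diameter bookkeeping on `Q(τ₁, R)`: `‖y − (τ₁, 0)‖ ≤ 1 + R`. [folklore] -/
theorem norm_sub_ofTimeSpace_le {y : E4} {τ₁ R : ℝ} (hR : 0 ≤ R) (hy0 : |y 0 - τ₁| ≤ 1)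
    (hy : ‖E4.spatial y‖ ≤ R) : ‖y - E4.ofTimeSpace τ₁ 0‖ ≤ 1 + R := by
  have h := norm_sq_eq_sq_add_spatialNorm_sq (y - E4.ofTimeSpace τ₁ 0)
  have h0 : (y - E4.ofTimeSpace τ₁ 0) 0 = y 0 - τ₁ := by rw [PiLp.sub_apply, E4.ofTimeSpace_apply_zero]
  have hs : E4.spatialNorm (y - E4.ofTimeSpace τ₁ 0) = ‖E4.spatial y‖ := by
    show ‖E4.spatial (y - E4.ofTimeSpace τ₁ 0)‖ = ‖E4.spatial y‖
    rw [map_sub, E4.spatial_ofTimeSpace, sub_zero]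
  rw [h0, hs] at h
  have h1 : (y 0 - τ₁) ^ 2 ≤ 1 := by
    have := abs_le.mp hy0
    nlinarith
  have h2 : ‖E4.spatial y‖ ^ 2 ≤ R ^ 2 := pow_le_pow_left₀ (norm_nonneg _) hy 2
  have h3 : ‖y - E4.ofTimeSpace τ₁ 0‖ ^ 2 ≤ (1 + R) ^ 2 := by rw [h]; nlinarith
  exact le_of_pow_le_pow_left₀ two_ne_zero (by positivity) h3

/-- **The frame defect** `E(y) = (Λ̃ (T y))⁻¹ ∘ Dψ(y) − 1` of the honest chart. [folklore] -/
def frameDefect (Λ : ℝ → lorentzGroup) (ξ : ℝ → E3) (T₀ : ℝ → ℝ) (y : E4) : E4 →L[ℝ] E4 :=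
  ((((Λ (clockMap Λ T₀ y) : E4 ≃L[ℝ] E4).symm : E4 ≃L[ℝ] E4) : E4 →L[ℝ] E4)).comp
      (fderiv ℝ (honestChart Λ ξ T₀) y) - ContinuousLinearMap.id ℝ E4

section Bounds

variable (Λ : ℝ → lorentzGroup) (ξ : ℝ → E3) (T₀ : ℝ → ℝ)
  (hΛ : ContDiff ℝ ∞ (fun t ↦ ((Λ t : E4 ≃L[ℝ] E4) : E4 →L[ℝ] E4)))
  (hξ : ContDiff ℝ ∞ ξ) (hT₀ : ContDiff ℝ ∞ T₀)
  (hclock : ∀ τ, HasDerivAt T₀ (frameVel (Λ (T₀ τ)) 0) τ)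
  {γ : ℝ} (hγ1 : 1 ≤ γ) (hu1 : ∀ t, 1 ≤ frameVel (Λ t) 0)
  (huγ : ∀ t, |((Λ t : E4 ≃L[ℝ] E4) (E4.basisVector 0)) 0| ≤ γ)
  {S δ : ℝ} (hδ0 : 0 ≤ δ) (hδ1 : δ ≤ 1)
  (hu' : ∀ s, S ≤ s → ‖deriv (fun t ↦ frameVel (Λ t) 0) s‖ ≤ δ)
  (hu'' : ∀ s, S ≤ s → ‖iteratedDeriv 2 (fun t ↦ frameVel (Λ t) 0) s‖ ≤ δ)
  (hL' : ∀ s, S ≤ s → ‖deriv (fun t ↦ frameTilt (Λ t)) s‖ ≤ δ)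
  (hL'' : ∀ s, S ≤ s → ‖iteratedDeriv 2 (fun t ↦ frameTilt (Λ t)) s‖ ≤ δ)
  (hL''' : ∀ s, S ≤ s → ‖iteratedDeriv 3 (fun t ↦ frameTilt (Λ t)) s‖ ≤ δ)
  (hP' : ∀ s, S ≤ s → ‖deriv (fun t ↦ purgedFrame (Λ t)) s‖ ≤ δ)
  (hP'' : ∀ s, S ≤ s → ‖iteratedDeriv 2 (fun t ↦ purgedFrame (Λ t)) s‖ ≤ δ)
  (hP''' : ∀ s, S ≤ s → ‖iteratedDeriv 3 (fun t ↦ purgedFrame (Λ t)) s‖ ≤ δ)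
  (hc' : ∀ s, S ≤ s → ‖deriv (centrePath ξ) s - normVel (Λ s)‖ ≤ δ)
  (hc'' : ∀ s, S ≤ s → ‖iteratedDeriv 2 (centrePath ξ) s‖ ≤ δ)
  (hc''' : ∀ s, S ≤ s → ‖iteratedDeriv 3 (centrePath ξ) s‖ ≤ δ)
  (hF' : ∀ s, S ≤ s → ‖deriv (fun t ↦ (((Λ t : E4 ≃L[ℝ] E4).symm : E4 ≃L[ℝ] E4) : E4 →L[ℝ] E4)) s‖ ≤ δ)
  (hF'' : ∀ s, S ≤ s →
    ‖iteratedDeriv 2 (fun t ↦ (((Λ t : E4 ≃L[ℝ] E4).symm : E4 ≃L[ℝ] E4) : E4 →L[ℝ] E4)) s‖ ≤ δ)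

include hΛ hξ hT₀ hclock hγ1 hu1 huγ hδ0 hδ1 hu' hu'' hL' hL'' hL''' hP' hP'' hP''' hc' hc'' hc''' hF' hF'' in
-- long chain of explicit bounds
set_option maxHeartbeats 800000 in
/-- **C² bound of the frame defect.** On `Q(τ₁, R)` (`|y⁰ − τ₁| ≤ 1`, `‖ỹ‖ ≤ R`), for a monotone
clock with `S + 4γR ≤ T₀(τ₁ − 1)`: `‖E(y)‖, ‖DE(y)‖, ‖D²E(y)‖ ≤ 6000 γ⁵ (1+R)⁶ δ`. [folklore] -/
theorem norm_iteratedFDeriv_frameDefect_le {R τ₁ : ℝ} (hR : 0 ≤ R) (hmono : Monotone T₀)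
    (hS : S + 4 * γ * R ≤ T₀ (τ₁ - 1)) {y : E4} (hy0 : |y 0 - τ₁| ≤ 1) (hy : ‖E4.spatial y‖ ≤ R) :
    ∀ k ≤ 2, ‖iteratedFDeriv ℝ k (frameDefect Λ ξ T₀) y‖ ≤ 6000 * γ ^ 5 * (1 + R) ^ 6 * δ := by
  set ρ : ℝ := 1 + R with hρ
  have hρ1 : 1 ≤ ρ := by rw [hρ]; linarith
  have hγ0 : 0 ≤ γ := by linarith
  have hRρ : R ≤ ρ := by rw [hρ]; linarith
  -- lateness of the relevant lab times
  have hτ : τ₁ - 1 ≤ y 0 := by rw [abs_sub_le_iff] at hy0; linarith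
  have hS1 : S + 4 * γ * R ≤ T₀ (y 0) := hS.trans (hmono hτ)
  have hS0 : S ≤ T₀ (y 0) := by linarith [mul_nonneg (mul_nonneg (by norm_num : (0:ℝ) ≤ 4) hγ0) hR]
  set T := clockMap Λ T₀ with hTdef
  have hT : S ≤ T y := by
    have h := abs_clockMap_sub_le Λ T₀ huγ y
    have h2 : 4 * γ * ‖E4.spatial y‖ ≤ 4 * γ * R := mul_le_mul_of_nonneg_left hy (by positivity)
    linarith [neg_abs_le (clockMap Λ T₀ y - T₀ (y 0))]
  -- smoothness
  have hTs : ContDiff ℝ ∞ T := contDiff_clockMap Λ T₀ hΛ hT₀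
  have hψ : ContDiff ℝ ∞ (honestChart Λ ξ T₀) := contDiff_honestChart Λ ξ T₀ hΛ hξ hT₀
  have hFs : ContDiff ℝ ∞ (fun t ↦ (((Λ t : E4 ≃L[ℝ] E4).symm : E4 ≃L[ℝ] E4) : E4 →L[ℝ] E4)) :=
    contDiff_lorentz_symm Λ hΛ
  set FT : E4 → E4 →L[ℝ] E4 := fun y ↦ (((Λ (T y) : E4 ≃L[ℝ] E4).symm : E4 ≃L[ℝ] E4) : E4 →L[ℝ] E4)
    with hFT
  have hFTs : ContDiff ℝ ∞ FT := hFs.comp hTs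
  set Λ₁ : E4 →L[ℝ] E4 := ((Λ (T₀ τ₁) : E4 ≃L[ℝ] E4) : E4 →L[ℝ] E4) with hΛ₁
  set W : E4 → E4 →L[ℝ] E4 := fun y ↦ fderiv ℝ (honestChart Λ ξ T₀) y - Λ₁ with hW
  have hWs : ContDiff ℝ ∞ W := (hψ.fderiv_right (m := ∞) le_rfl).sub contDiff_const
  -- clock map bounds at `y`
  obtain ⟨d1, d2, -⟩ := norm_iteratedFDeriv_clockMap_le Λ T₀ hΛ hT₀ hclock hγ1 hu1 huγ hδ0 hδ1 hu' hu''
    hL' hL'' hL''' hR hy hS0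
  -- derivatives of `FT = F⁻¹ ∘ T`
  have hq1 := norm_iteratedFDeriv_one_comp_scalar_le (hFs.differentiable (by simp))
    (hTs.differentiable (by simp)) y (hF' _ hT) d1
  have hq2 := norm_iteratedFDeriv_two_comp_scalar_le (hFs.of_le (WithTop.coe_le_coe.mpr le_top))
    (hTs.of_le (WithTop.coe_le_coe.mpr le_top)) y (hF' _ hT) (hF'' _ hT) d1 d2
  have hFT0 : ‖FT y‖ ≤ 4 * γ := norm_lorentz_symm_le_four_mul Λ huγ _
  have m := fun (a b c d : ℕ) (hab : a ≤ b) (hcd : c ≤ d) ↦ monomial_mono hγ1 hρ1 hδ0 hab hcd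
  have f1 : ‖iteratedFDeriv ℝ 1 FT y‖ ≤ 5 * (γ ^ 1 * ρ ^ 1 * δ) := by
    have h1 : δ * (5 * γ * (1 + R)) = 5 * (γ ^ 1 * ρ ^ 1 * δ) := by rw [hρ]; ring
    linarith [hq1]
  have f2 : ‖iteratedFDeriv ℝ 2 FT y‖ ≤ 28 * (γ ^ 2 * ρ ^ 2 * δ) := by
    have h1 : δ * (5 * γ * (1 + R)) ^ 2 = 25 * (γ ^ 2 * ρ ^ 2 * δ) := by rw [hρ]; ring
    have h2 : δ * (3 * γ ^ 2 * (1 + R) * δ) = 3 * (γ ^ 2 * ρ ^ 1 * δ) * δ := by rw [hρ]; ring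
    have := m 2 2 1 2 le_rfl (by norm_num)
    have h4 : (γ ^ 2 * ρ ^ 1 * δ) * δ ≤ γ ^ 2 * ρ ^ 1 * δ := mul_le_of_le_one_right (by positivity) hδ1
    linarith [hq2]
  -- bounds on `W = Dψ − Λ₁` and its derivatives
  have w0 : ‖W y‖ ≤ 83 * γ ^ 3 * ρ ^ 4 * δ := by
    have := norm_fderiv_honestChart_sub_frame_le Λ ξ T₀ hΛ hξ hT₀ hclock hγ1 hu1 huγ hδ0 hδ1 hu' hu''
      hL' hL'' hL''' hP' hP'' hP''' hc' hc'' hc''' hR hmono hS hy0 hy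
    simpa [hW, hρ] using this
  obtain ⟨b2, b3⟩ := norm_iteratedFDeriv_honestChart_le Λ ξ T₀ hΛ hξ hT₀ hclock hγ1 hu1 huγ hδ0 hδ1
    hu' hu'' hL' hL'' hL''' hP' hP'' hP''' hc' hc'' hc''' hR hy hS1
  have hWk : ∀ k : ℕ, 1 ≤ k → iteratedFDeriv ℝ k W y =
      iteratedFDeriv ℝ k (fderiv ℝ (honestChart Λ ξ T₀)) y := fun k hk ↦ by
    have hW' : W = fderiv ℝ (honestChart Λ ξ T₀) - fun _ ↦ Λ₁ := rfl
    rw [hW', iteratedFDeriv_sub_apply ((hψ.fderiv_right (m := ∞) le_rfl).of_le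
      (WithTop.coe_le_coe.mpr le_top)).contDiffAt contDiffAt_const,
      iteratedFDeriv_const_of_ne (by omega), Pi.zero_apply, sub_zero]
  have w1 : ‖iteratedFDeriv ℝ 1 W y‖ ≤ 78 * γ ^ 3 * ρ ^ 3 * δ := by
    rw [hWk 1 le_rfl, norm_iteratedFDeriv_fderiv]; simpa [hρ] using b2
  have w2 : ‖iteratedFDeriv ℝ 2 W y‖ ≤ 472 * γ ^ 4 * ρ ^ 4 * δ := by
    rw [hWk 2 (by norm_num), norm_iteratedFDeriv_fderiv]; simpa [hρ] using b3
  -- the two parts `H = FT ∘ W`, `G = FT ∘ Λ₁ − 1`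
  letI : NormedAddCommGroup ((E4 →L[ℝ] E4) →L[ℝ] (E4 →L[ℝ] E4)) := ContinuousLinearMap.toNormedAddCommGroup
  letI : NormedSpace ℝ ((E4 →L[ℝ] E4) →L[ℝ] (E4 →L[ℝ] E4)) := ContinuousLinearMap.toNormedSpace
  set B : (E4 →L[ℝ] E4) →L[ℝ] (E4 →L[ℝ] E4) →L[ℝ] (E4 →L[ℝ] E4) := ContinuousLinearMap.compL ℝ E4 E4 E4
    with hB
  have hBn : ‖B‖ ≤ 1 := ContinuousLinearMap.norm_compL_le ℝ E4 E4 E4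
  set H : E4 → E4 →L[ℝ] E4 := fun y ↦ B (FT y) (W y) with hH
  set Bp : (E4 →L[ℝ] E4) →L[ℝ] (E4 →L[ℝ] E4) := B.flip Λ₁ with hBp
  have hBpn : ‖Bp‖ ≤ 4 * γ := by
    refine (B.flip.le_opNorm Λ₁).trans ?_
    rw [ContinuousLinearMap.opNorm_flip]
    calc ‖B‖ * ‖Λ₁‖ ≤ 1 * (4 * γ) := mul_le_mul hBn (norm_frame_le_four_mul Λ huγ _) (norm_nonneg _)
          zero_le_one
      _ = 4 * γ := one_mul _
  set G : E4 → E4 →L[ℝ] E4 := fun y ↦ Bp (FT y) - ContinuousLinearMap.id ℝ E4 with hG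
  have hfun : frameDefect Λ ξ T₀ = H + G := by
    funext z
    simp only [frameDefect, hH, hG, hBp, hB, Pi.add_apply, ContinuousLinearMap.flip_apply,
      ContinuousLinearMap.compL_apply, hW, hFT, ContinuousLinearMap.comp_sub]
    abel
  have hHs : ContDiff ℝ ∞ H := B.isBoundedBilinearMap.contDiff.comp (hFTs.prodMk hWs)
  have hGs : ContDiff ℝ ∞ G := (Bp.contDiff.comp hFTs).sub contDiff_const
  -- Leibniz for `H`
  have hH0 : ‖H y‖ ≤ 332 * (γ ^ 4 * ρ ^ 4 * δ) := by
    have h1 : ‖H y‖ ≤ ‖B‖ * ‖FT y‖ * ‖W y‖ := B.le_opNorm₂ _ _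
    have h2 : ‖B‖ * ‖FT y‖ * ‖W y‖ ≤ 1 * (4 * γ) * (83 * γ ^ 3 * ρ ^ 4 * δ) :=
      mul_le_mul (mul_le_mul hBn hFT0 (norm_nonneg _) zero_le_one) w0 (norm_nonneg _) (by positivity)
    have h3 : 1 * (4 * γ) * (83 * γ ^ 3 * ρ ^ 4 * δ) = 332 * (γ ^ 4 * ρ ^ 4 * δ) := by ring
    linarith
  have hH1 : ‖iteratedFDeriv ℝ 1 H y‖ ≤ 727 * (γ ^ 4 * ρ ^ 5 * δ) := by
    have h := B.norm_iteratedFDeriv_le_of_bilinear_of_le_one hFTs hWs y (n := 1)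
      (WithTop.coe_le_coe.mpr le_top) hBn
    have hsum : ∑ i ∈ Finset.range (1 + 1), ((1 : ℕ).choose i : ℝ) * ‖iteratedFDeriv ℝ i FT y‖ *
        ‖iteratedFDeriv ℝ (1 - i) W y‖ = ‖FT y‖ * ‖iteratedFDeriv ℝ 1 W y‖ +
          ‖iteratedFDeriv ℝ 1 FT y‖ * ‖W y‖ := by
      simp [Finset.sum_range_succ]
    rw [hsum] at h
    have e1 : ‖FT y‖ * ‖iteratedFDeriv ℝ 1 W y‖ ≤ 4 * γ * (78 * γ ^ 3 * ρ ^ 3 * δ) :=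
      mul_le_mul hFT0 w1 (norm_nonneg _) (by positivity)
    have e2 : ‖iteratedFDeriv ℝ 1 FT y‖ * ‖W y‖ ≤ 5 * (γ ^ 1 * ρ ^ 1 * δ) * (83 * γ ^ 3 * ρ ^ 4 * δ) :=
      mul_le_mul f1 w0 (norm_nonneg _) (by positivity)
    have e3 : 4 * γ * (78 * γ ^ 3 * ρ ^ 3 * δ) = 312 * (γ ^ 4 * ρ ^ 3 * δ) := by ring
    have e4 : 5 * (γ ^ 1 * ρ ^ 1 * δ) * (83 * γ ^ 3 * ρ ^ 4 * δ) = 415 * (γ ^ 4 * ρ ^ 5 * δ) * δ := by ring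
    have e5 : (γ ^ 4 * ρ ^ 5 * δ) * δ ≤ γ ^ 4 * ρ ^ 5 * δ := mul_le_of_le_one_right (by positivity) hδ1
    have := m 4 4 3 5 le_rfl (by norm_num)
    linarith
  have hH2 : ‖iteratedFDeriv ℝ 2 H y‖ ≤ 4992 * (γ ^ 5 * ρ ^ 6 * δ) := by
    have h := B.norm_iteratedFDeriv_le_of_bilinear_of_le_one hFTs hWs y (n := 2)
      (WithTop.coe_le_coe.mpr le_top) hBn
    have hsum : ∑ i ∈ Finset.range (2 + 1), ((2 : ℕ).choose i : ℝ) * ‖iteratedFDeriv ℝ i FT y‖ *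
        ‖iteratedFDeriv ℝ (2 - i) W y‖ = ‖FT y‖ * ‖iteratedFDeriv ℝ 2 W y‖ +
          2 * ‖iteratedFDeriv ℝ 1 FT y‖ * ‖iteratedFDeriv ℝ 1 W y‖ +
          ‖iteratedFDeriv ℝ 2 FT y‖ * ‖W y‖ := by
      simp [Finset.sum_range_succ]
    rw [hsum] at h
    have e1 : ‖FT y‖ * ‖iteratedFDeriv ℝ 2 W y‖ ≤ 4 * γ * (472 * γ ^ 4 * ρ ^ 4 * δ) :=
      mul_le_mul hFT0 w2 (norm_nonneg _) (by positivity)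
    have e2 : 2 * ‖iteratedFDeriv ℝ 1 FT y‖ * ‖iteratedFDeriv ℝ 1 W y‖ ≤
        2 * (5 * (γ ^ 1 * ρ ^ 1 * δ)) * (78 * γ ^ 3 * ρ ^ 3 * δ) :=
      mul_le_mul (by linarith [f1]) w1 (norm_nonneg _) (by positivity)
    have e3 : ‖iteratedFDeriv ℝ 2 FT y‖ * ‖W y‖ ≤ 28 * (γ ^ 2 * ρ ^ 2 * δ) * (83 * γ ^ 3 * ρ ^ 4 * δ) :=
      mul_le_mul f2 w0 (norm_nonneg _) (by positivity)
    have e4 : 4 * γ * (472 * γ ^ 4 * ρ ^ 4 * δ) = 1888 * (γ ^ 5 * ρ ^ 4 * δ) := by ring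
    have e5 : 2 * (5 * (γ ^ 1 * ρ ^ 1 * δ)) * (78 * γ ^ 3 * ρ ^ 3 * δ) = 780 * (γ ^ 4 * ρ ^ 4 * δ) * δ := by
      ring
    have e6 : 28 * (γ ^ 2 * ρ ^ 2 * δ) * (83 * γ ^ 3 * ρ ^ 4 * δ) = 2324 * (γ ^ 5 * ρ ^ 6 * δ) * δ := by
      ring
    have e7 : (γ ^ 4 * ρ ^ 4 * δ) * δ ≤ γ ^ 4 * ρ ^ 4 * δ := mul_le_of_le_one_right (by positivity) hδ1
    have e8 : (γ ^ 5 * ρ ^ 6 * δ) * δ ≤ γ ^ 5 * ρ ^ 6 * δ := mul_le_of_le_one_right (by positivity) hδ1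
    have := m 5 5 4 6 le_rfl (by norm_num)
    have := m 4 5 4 6 (by norm_num) (by norm_num)
    linarith
  -- `G`: vanishes at the centre, derivatives through `FT`
  set y₁ : E4 := E4.ofTimeSpace τ₁ 0 with hy₁
  have hy₁0 : y₁ 0 = τ₁ := E4.ofTimeSpace_apply_zero _ _
  have hy₁s : E4.spatial y₁ = 0 := E4.spatial_ofTimeSpace _ _
  have hG0y₁ : G y₁ = 0 := by
    have hT₁ : T y₁ = T₀ τ₁ := by rw [hTdef, clockMap_of_spatial_eq_zero Λ T₀ hy₁s, hy₁0]
    simp only [hG, hBp, hB, hFT, ContinuousLinearMap.flip_apply, ContinuousLinearMap.compL_apply, hT₁, hΛ₁]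
    rw [sub_eq_zero]
    ext v
    simp
  have hG' : G = (⇑Bp ∘ FT) - fun _ ↦ ContinuousLinearMap.id ℝ E4 := rfl
  have hGk' : ∀ (z : E4) (k : ℕ), 1 ≤ k → ‖iteratedFDeriv ℝ k G z‖ ≤ 4 * γ * ‖iteratedFDeriv ℝ k FT z‖ := by
    intro z k hk
    rw [hG', iteratedFDeriv_sub_apply ((Bp.contDiff.comp hFTs).of_le
      (WithTop.coe_le_coe.mpr le_top)).contDiffAt contDiffAt_const, iteratedFDeriv_const_of_ne (by omega),
      Pi.zero_apply, sub_zero]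
    exact (norm_iteratedFDeriv_clm_comp_left_le Bp hFTs z k).trans
      (mul_le_mul_of_nonneg_right hBpn (norm_nonneg _))
  have hGk : ∀ k : ℕ, 1 ≤ k → ‖iteratedFDeriv ℝ k G y‖ ≤ 4 * γ * ‖iteratedFDeriv ℝ k FT y‖ := hGk' y
  have h4γ : (0:ℝ) ≤ 4 * γ := by positivity
  have hG1 : ‖iteratedFDeriv ℝ 1 G y‖ ≤ 20 * (γ ^ 2 * ρ ^ 1 * δ) := by
    have := hGk 1 le_rfl
    have e : 4 * γ * (5 * (γ ^ 1 * ρ ^ 1 * δ)) = 20 * (γ ^ 2 * ρ ^ 1 * δ) := by ring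
    have := mul_le_mul_of_nonneg_left f1 h4γ
    linarith
  have hG2 : ‖iteratedFDeriv ℝ 2 G y‖ ≤ 112 * (γ ^ 3 * ρ ^ 2 * δ) := by
    have := hGk 2 (by norm_num)
    have e : 4 * γ * (28 * (γ ^ 2 * ρ ^ 2 * δ)) = 112 * (γ ^ 3 * ρ ^ 2 * δ) := by ring
    have := mul_le_mul_of_nonneg_left f2 h4γ
    linarith
  -- `‖G y‖` by the mean value theorem from the centre over `Q`
  have hG0 : ‖G y‖ ≤ 20 * (γ ^ 2 * ρ ^ 2 * δ) := by
    set Qs : Set E4 := {z | z 0 ∈ Icc (τ₁ - 1) (τ₁ + 1)} ∩ {z | E4.spatial z ∈ closedBall (0 : E3) R}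
      with hQ
    have hQc : Convex ℝ Qs :=
      ((convex_Icc _ _).linear_preimage ((EuclideanSpace.proj (0 : Fin 4) : E4 →L[ℝ] ℝ) : E4 →ₗ[ℝ] ℝ)).inter
        ((convex_closedBall _ _).linear_preimage (E4.spatial : E4 →ₗ[ℝ] E3))
    have hmemQ : ∀ z : E4, |z 0 - τ₁| ≤ 1 → ‖E4.spatial z‖ ≤ R → z ∈ Qs := fun z hz0 hz ↦ by
      refine ⟨?_, by simpa using hz⟩
      show z 0 ∈ Icc (τ₁ - 1) (τ₁ + 1)
      rw [abs_sub_le_iff] at hz0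
      exact ⟨by linarith, by linarith⟩
    have hyQ : y ∈ Qs := hmemQ y hy0 hy
    have hy₁Q : y₁ ∈ Qs := hmemQ y₁ (by rw [hy₁0, sub_self, abs_zero]; exact zero_le_one)
      (by rw [hy₁s, norm_zero]; exact hR)
    -- the derivative bound on `Qs`: the same estimate at every point of `Qs`
    have hbound : ∀ z ∈ Qs, ‖fderiv ℝ G z‖ ≤ 20 * (γ ^ 2 * ρ ^ 1 * δ) := by
      intro z hz
      have hz0 : |z 0 - τ₁| ≤ 1 := by
        have h := hz.1; rw [mem_setOf_eq, mem_Icc] at h; rw [abs_sub_le_iff]; constructor <;> linarith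
      have hz' : ‖E4.spatial z‖ ≤ R := by simpa using hz.2
      -- recompute `f1` at `z`
      have hτz : τ₁ - 1 ≤ z 0 := by rw [abs_sub_le_iff] at hz0; linarith
      have hSz : S ≤ T₀ (z 0) := by
        linarith [hS.trans (hmono hτz), mul_nonneg (mul_nonneg (by norm_num : (0:ℝ) ≤ 4) hγ0) hR]
      have hTz : S ≤ T z := by
        have h := abs_clockMap_sub_le Λ T₀ huγ z
        have h2 : 4 * γ * ‖E4.spatial z‖ ≤ 4 * γ * R := mul_le_mul_of_nonneg_left hz' (by positivity)
        linarith [neg_abs_le (clockMap Λ T₀ z - T₀ (z 0)), hS.trans (hmono hτz)]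
      obtain ⟨dz1, -, -⟩ := norm_iteratedFDeriv_clockMap_le Λ T₀ hΛ hT₀ hclock hγ1 hu1 huγ hδ0 hδ1 hu' hu''
        hL' hL'' hL''' hR hz' hSz
      have hqz1 := norm_iteratedFDeriv_one_comp_scalar_le (hFs.differentiable (by simp))
        (hTs.differentiable (by simp)) z (hF' _ hTz) dz1
      have fz1 : ‖iteratedFDeriv ℝ 1 FT z‖ ≤ 5 * (γ ^ 1 * ρ ^ 1 * δ) := by
        have h1 : δ * (5 * γ * (1 + R)) = 5 * (γ ^ 1 * ρ ^ 1 * δ) := by rw [hρ]; ring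
        linarith [hqz1]
      have hGz : ‖iteratedFDeriv ℝ 1 G z‖ ≤ 4 * γ * ‖iteratedFDeriv ℝ 1 FT z‖ := hGk' z 1 le_rfl
      rw [← norm_iteratedFDeriv_zero (𝕜 := ℝ) (f := fderiv ℝ G), norm_iteratedFDeriv_fderiv]
      have e : 4 * γ * (5 * (γ ^ 1 * ρ ^ 1 * δ)) = 20 * (γ ^ 2 * ρ ^ 1 * δ) := by ring
      have := mul_le_mul_of_nonneg_left fz1 h4γ
      linarith
    have hdiff : ∀ z ∈ Qs, DifferentiableAt ℝ G z := fun z _ ↦ (hGs.differentiable (by simp)) z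
    have hmvt := hQc.norm_image_sub_le_of_norm_fderiv_le hdiff hbound hy₁Q hyQ
    rw [hG0y₁, sub_zero] at hmvt
    have hdist : ‖y - y₁‖ ≤ ρ := by rw [hy₁, hρ]; exact norm_sub_ofTimeSpace_le hR hy0 hy
    have e : 20 * (γ ^ 2 * ρ ^ 1 * δ) * ρ = 20 * (γ ^ 2 * ρ ^ 2 * δ) := by ring
    have := mul_le_mul_of_nonneg_left hdist (show (0:ℝ) ≤ 20 * (γ ^ 2 * ρ ^ 1 * δ) by positivity)
    linarith [hmvt]
  -- assemble
  have hadd : ∀ k : ℕ, iteratedFDeriv ℝ k (frameDefect Λ ξ T₀) y =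
      iteratedFDeriv ℝ k H y + iteratedFDeriv ℝ k G y := fun k ↦ by
    rw [hfun]
    exact iteratedFDeriv_add_apply (hHs.of_le (WithTop.coe_le_coe.mpr le_top)).contDiffAt
      (hGs.of_le (WithTop.coe_le_coe.mpr le_top)).contDiffAt
  have hfin : 6000 * γ ^ 5 * (1 + R) ^ 6 * δ = 6000 * (γ ^ 5 * ρ ^ 6 * δ) := by rw [hρ]; ring
  have hc0 : 0 ≤ γ ^ 5 * ρ ^ 6 * δ := by positivity
  intro k hk
  rw [hadd k, hfin]
  refine (norm_add_le _ _).trans ?_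
  interval_cases k
  · rw [norm_iteratedFDeriv_zero, norm_iteratedFDeriv_zero]
    have := m 4 5 4 6 (by norm_num) (by norm_num)
    have := m 2 5 2 6 (by norm_num) (by norm_num)
    linarith [hH0, hG0]
  · have := m 4 5 5 6 (by norm_num) (by norm_num)
    have := m 2 5 1 6 (by norm_num) (by norm_num)
    linarith [hH1, hG1]
  · have := m 3 5 2 6 (by norm_num) (by norm_num)
    linarith [hH2, hG2]

end Bounds

/-- Registered one-line form (worker carrier `rechart_norm_sub_ofTimeSpace_le`). [folklore] -/
theorem rechart_norm_sub_ofTimeSpace_le : open Literature.Geometry.Lorentzian in ∀ {y : E4} {τ₁ R : ℝ}, 0 ≤ R → |y 0 - τ₁| ≤ 1 → ‖E4.spatial y‖ ≤ R → ‖y - E4.ofTimeSpace τ₁ 0‖ ≤ 1 + R := fun hR hy0 hy ↦ norm_sub_ofTimeSpace_le hR hy0 hy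

end Summit.FinalStateConjecture.FinalStateConjecture.Theorems.SublinearIsFree.Rechart

end
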